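import Mathlib
import Summits.QuantumAdvantage.QuantumAdvantage.Theorems.MobiusLadderLiouvilleOrthogonalTC0SensLtf
import Summits.QuantumAdvantage.QuantumAdvantage.Theorems.MobiusLadderLiouvilleOrthogonalTC0StubDepthOneLtf
import HarnessLib

/-!
# Crux `MobiusLadder.LiouvilleOrthogonalTC0` (stmt-QuantumAdvantage-1393), line `Sketch` (v5):
# stub `stub_sizeK_sens` — block sensitivity of bounded-size threshold circuits

A circuit over `tcBasis = {¬} ∪ {∧ₖ, ∨ₖ, MAJₖ : k ∈ ℕ}` with at most `K` gates (any depth, any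
fan-in) has, for every map `π : Fin n → Fin m` (a partition of the `n` inputs into `m` blocks),
block sensitivity

  `Σ_x #{j : C(x) ≠ C(x ⊕ 1_{π⁻¹ j})} ≤ 3^K · 2ⁿ √m`.

Proof (reverse induction over the straight-line program `C.gates`). Write `Z = 2ⁿ √m` and
`sens(v) = Σ_x #{j : v(x) ≠ v(x ⊕ 1_{π⁻¹ j})}`. CLAIM: gate `t` of a program over `tcBasis` has
`sens ≤ 3ᵗ · Z`.

* A `¬` gate negates one wire: an input (`sens = 2ⁿ ≤ Z`), an earlier gate `l < t`
  (`sens ≤ 3ˡ Z ≤ 3ᵗ Z`) or an out-of-range back-reference (the constant `false`, `sens = 0`).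
* Any other gate of `tcBasis` is a threshold `[θ ≤ c · #ones]` of its argument wires
  (`exists_threshold_of_mem_tcBasis`). For every PATTERN `p : Fin t → Bool` of values of the earlier
  gates, the gate with the back-references frozen to `p` is an integer linear threshold function
  `L_p` of the inputs (`DepthOneLtf.ltf_gate`), so `sens(L_p) ≤ Z` (`SensLtf.sens_intLtf_le`, Peres),
  and the gate value at `x` is `L_{v(x)}(x)` with `v(x)` the vector of earlier gate values. UNION
  BOUND: if the gate value changes from `x` to `x'` then either some earlier gate `l < t` changes, or
  `v(x) = v(x')` and `L_{v(x)}` changes; hence `sens ≤ Σ_{l<t} sens(gate l) + Σ_p sens(L_p)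
  ≤ (Σ_{l<t} 3ˡ + 2ᵗ) Z ≤ 3ᵗ Z`.

The output wire is an input (`sens = 2ⁿ`) or a gate `t < size ≤ K`.
-/

set_option linter.dupNamespace false -- D-0017: single-problem summit ⇒ `QuantumAdvantage.QuantumAdvantage` by design

noncomputable section

namespace Summit.QuantumAdvantage.QuantumAdvantage.Theorems.LiouvilleOrthogonalTC0

open Finset
open Literature.Computability.Complexity
open Literature.Computability.Complexity.GateList

namespace SizeKSens

variable {n m : ℕ}

/-- `Σ_{l<T} 3ˡ + 2ᵀ ≤ 3ᵀ` (the bookkeeping of the union bound). -/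
theorem geom_three_two (T : ℕ) : (∑ l ∈ range T, (3 : ℝ) ^ l) + 2 ^ T ≤ 3 ^ T := by
  induction T with
  | zero => simp
  | succ T ih =>
    rw [sum_range_succ, pow_succ, pow_succ]
    have h : (2 : ℝ) ^ T ≤ 3 ^ T := pow_le_pow_left₀ (by norm_num) (by norm_num) T
    linarith

/-- Block sensitivity of an input variable: every point is sensitive to exactly the block of `i`,
so `sens(x ↦ x i) = 2ⁿ ≤ 3ᵗ · 2ⁿ √m` (`m ≥ 1`). -/
theorem sens_input_le (hm : 1 ≤ m) (π : Fin n → Fin m) (i : Fin n) (t : ℕ) :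
    ∑ x : Fin n → Bool, ((univ.filter fun j : Fin m =>
        x i ≠ xor (x i) (decide (π i = j))).card : ℝ)
      ≤ 3 ^ t * (2 ^ n * Real.sqrt m) := by
  have hxor : ∀ a b : Bool, (a ≠ xor a b) ↔ b = true := by decide
  have h1 : ∀ x : Fin n → Bool,
      (univ.filter fun j : Fin m => x i ≠ xor (x i) (decide (π i = j))) = {π i} := by
    intro x
    ext j
    simp only [mem_filter, mem_univ, true_and, mem_singleton, hxor, decide_eq_true_eq]
    exact eq_comm
  simp only [h1, card_singleton, Nat.cast_one, sum_const, card_univ, Fintype.card_fun,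
    Fintype.card_bool, Fintype.card_fin, nsmul_eq_mul, mul_one, Nat.cast_pow, Nat.cast_ofNat]
  have h3 : (1 : ℝ) ≤ 3 ^ t := one_le_pow₀ (by norm_num)
  have hsq : (1 : ℝ) ≤ Real.sqrt m := Real.one_le_sqrt.2 (by exact_mod_cast hm)
  have h2 : (0 : ℝ) ≤ 2 ^ n := by positivity
  calc (2 : ℝ) ^ n = 1 * (2 ^ n * 1) := by ring
    _ ≤ 3 ^ t * (2 ^ n * Real.sqrt m) :=
        mul_le_mul h3 (mul_le_mul_of_nonneg_left hsq h2) (by positivity) (by positivity)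

/-- **The union bound.** If `f(x) = G (V x) x` is selected, by a vector `V x ∈ {0,1}ᵀ` of
auxiliary Boolean functions, among `2ᵀ` functions `G p`, then
`sens(f) ≤ Σ_l sens(V · l) + Σ_p sens(G p)`: a sensitive block of `f` at `x` changes some `V · l`,
or changes `G_{V x}`. -/
theorem sens_select_le {T : ℕ} (π : Fin n → Fin m) (f : (Fin n → Bool) → Bool)
    (V : (Fin n → Bool) → Fin T → Bool) (G : (Fin T → Bool) → (Fin n → Bool) → Bool)
    (hf : ∀ x, f x = G (V x) x) {b : Fin T → ℝ} {c : ℝ}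
    (hV : ∀ l : Fin T, ∑ x : Fin n → Bool, ((univ.filter fun j : Fin m =>
      V x l ≠ V (fun i => xor (x i) (decide (π i = j))) l).card : ℝ) ≤ b l)
    (hG : ∀ p : Fin T → Bool, ∑ x : Fin n → Bool, ((univ.filter fun j : Fin m =>
      G p x ≠ G p (fun i => xor (x i) (decide (π i = j)))).card : ℝ) ≤ c) :
    ∑ x : Fin n → Bool, ((univ.filter fun j : Fin m =>
        f x ≠ f (fun i => xor (x i) (decide (π i = j)))).card : ℝ)
      ≤ ∑ l, b l + 2 ^ T * c := by
  -- the pointwise union bound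
  have key : ∀ x : Fin n → Bool, ((univ.filter fun j : Fin m =>
      f x ≠ f (fun i => xor (x i) (decide (π i = j)))).card : ℝ) ≤
      ∑ l : Fin T, ((univ.filter fun j : Fin m =>
        V x l ≠ V (fun i => xor (x i) (decide (π i = j))) l).card : ℝ) +
      ∑ p : Fin T → Bool, ((univ.filter fun j : Fin m =>
        G p x ≠ G p (fun i => xor (x i) (decide (π i = j)))).card : ℝ) := by
    intro x
    have hsub : (univ.filter fun j : Fin m => f x ≠ f (fun i => xor (x i) (decide (π i = j)))) ⊆
        (univ.biUnion fun l : Fin T => univ.filter fun j : Fin m =>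
          V x l ≠ V (fun i => xor (x i) (decide (π i = j))) l) ∪
        (univ.biUnion fun p : Fin T → Bool => univ.filter fun j : Fin m =>
          G p x ≠ G p (fun i => xor (x i) (decide (π i = j)))) := by
      intro j hj
      simp only [mem_filter, mem_univ, true_and] at hj
      simp only [mem_union, mem_biUnion, mem_filter, mem_univ, true_and]
      by_cases hVx : V x = V (fun i => xor (x i) (decide (π i = j)))
      · right
        refine ⟨V x, ?_⟩
        rwa [hf, hf, ← hVx] at hj
      · left
        exact Function.ne_iff.1 hVx
    have hnat := (card_le_card hsub).trans
      ((card_union_le _ _).trans (add_le_add card_biUnion_le card_biUnion_le))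
    exact_mod_cast hnat
  calc _ ≤ ∑ x : Fin n → Bool, (∑ l : Fin T, ((univ.filter fun j : Fin m =>
          V x l ≠ V (fun i => xor (x i) (decide (π i = j))) l).card : ℝ) +
        ∑ p : Fin T → Bool, ((univ.filter fun j : Fin m =>
          G p x ≠ G p (fun i => xor (x i) (decide (π i = j)))).card : ℝ)) :=
        sum_le_sum fun x _ => key x
    _ = ∑ l : Fin T, ∑ x : Fin n → Bool, ((univ.filter fun j : Fin m =>
          V x l ≠ V (fun i => xor (x i) (decide (π i = j))) l).card : ℝ) +
        ∑ p : Fin T → Bool, ∑ x : Fin n → Bool, ((univ.filter fun j : Fin m =>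
          G p x ≠ G p (fun i => xor (x i) (decide (π i = j)))).card : ℝ) := by
        rw [sum_add_distrib]
        congr 1
        · exact sum_comm
        · exact sum_comm
    _ ≤ ∑ l, b l + ∑ _p : Fin T → Bool, c :=
        add_le_add (sum_le_sum fun l _ => hV l) (sum_le_sum fun p _ => hG p)
    _ = ∑ l, b l + 2 ^ T * c := by
        simp only [sum_const, card_univ, Fintype.card_fun, Fintype.card_bool, Fintype.card_fin,
          nsmul_eq_mul, Nat.cast_pow, Nat.cast_ofNat]

/-- **The gate invariant.** In a program over `tcBasis`, gate `t` has block sensitivity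
`≤ 3ᵗ · 2ⁿ √m` for every partition `π` (`m ≥ 1`; `i₀` witnesses `n ≥ 1`). -/
theorem sens_vals_le (i₀ : Fin n) (hm : 1 ≤ m) (π : Fin n → Fin m) (gs : List (Gate (Fin n)))
    (hB : ∀ g ∈ gs, g.fn ∈ tcBasis) {t : ℕ} (ht : t < gs.length) :
    ∑ x : Fin n → Bool, ((univ.filter fun j : Fin m =>
        (vals gs x).getD t false ≠
          (vals gs (fun i => xor (x i) (decide (π i = j)))).getD t false).card : ℝ)
      ≤ 3 ^ t * (2 ^ n * Real.sqrt m) := by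
  induction gs using List.reverseRecOn generalizing t with
  | nil => exact absurd ht (Nat.not_lt_zero t)
  | append_singleton gs g ih =>
    have hB' : ∀ g' ∈ gs, g'.fn ∈ tcBasis := fun g' hg' => hB g' (List.mem_append_left _ hg')
    have hgB : g.fn ∈ tcBasis := hB g (List.mem_append_right _ (List.mem_singleton_self g))
    have hZ : (0 : ℝ) ≤ 2 ^ n * Real.sqrt m := by positivity
    rw [List.length_append, List.length_singleton] at ht
    rcases Nat.lt_succ_iff_lt_or_eq.1 ht with hlt | rfl
    · -- a gate of the prefix: its value is unchanged
      have hval : ∀ x : Fin n → Bool, (vals (gs ++ [g]) x).getD t false = (vals gs x).getD t false :=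
        fun x => by
          rw [vals_append_singleton, List.getD_append (vals gs x) _ false t (by simpa using hlt)]
      simp only [hval]
      exact ih hB' hlt
    · -- the new gate
      have hval : ∀ x : Fin n → Bool, (vals (gs ++ [g]) x).getD gs.length false =
          g.op (fun a => wireOf x (vals gs x) (g.args a)) :=
        fun x => getD_vals_append_singleton gs g x
      simp only [hval]
      by_cases hnot : g.fn = GateFn.not
      · -- a `¬` gate: it negates one wire
        obtain ⟨a₀, hop⟩ := DepthOneLtf.op_eq_not_of_fn_eq_not g hnot
        have hnn : ∀ a b : Bool, ((!a) ≠ !b) ↔ (a ≠ b) := by decide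
        simp only [hop, hnn]
        rcases g.args a₀ with i | l
        · simp only [wireOf_inl]
          exact sens_input_le hm π i _
        · simp only [wireOf_inr]
          by_cases hl : l < gs.length
          · exact (ih hB' hl).trans
              (mul_le_mul_of_nonneg_right (pow_le_pow_right₀ (by norm_num) hl.le) hZ)
          · have hjunk : ∀ x : Fin n → Bool, (vals gs x).getD l false = false := fun x =>
              List.getD_eq_default _ _ (by rw [length_vals]; omega)
            simp only [hjunk, ne_eq, not_true_eq_false, filter_false, card_empty, Nat.cast_zero,
              sum_const_zero]
            positivity
      · -- a threshold gate: one of `2ᵗ` integer threshold functions, selected by the earlier values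
        have hV : ∀ x : Fin n → Bool,
            List.ofFn (fun l : Fin gs.length => (vals gs x).getD l false) = vals gs x := by
          intro x
          apply List.ext_getElem
          · simp
          · intro k _ h2
            simp only [List.getElem_ofFn]
            exact List.getD_eq_getElem _ _ h2
        have hf : ∀ x : Fin n → Bool, (fun y : Fin n → Bool => g.op (fun a => wireOf y (vals gs y) (g.args a))) x =
            (fun (p : Fin gs.length → Bool) (y : Fin n → Bool) =>
              g.op (fun a => wireOf y (List.ofFn p) (g.args a)))
              ((fun (y : Fin n → Bool) (l : Fin gs.length) => (vals gs y).getD l false) x) x := by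
          intro x
          simp only [hV]
        have hGp : ∀ p : Fin gs.length → Bool, ∑ x : Fin n → Bool, ((univ.filter fun j : Fin m =>
            g.op (fun a => wireOf x (List.ofFn p) (g.args a)) ≠
              g.op (fun a => wireOf (fun i => xor (x i) (decide (π i = j))) (List.ofFn p)
                (g.args a))).card : ℝ) ≤ 2 ^ n * Real.sqrt m := by
          intro p
          obtain ⟨w, θ, hG⟩ := DepthOneLtf.ltf_gate g hgB hnot
            (fun a y => wireOf y (List.ofFn p) (g.args a)) (fun a => by
              rcases g.args a with i | l
              · exact ⟨i, 1, 0, fun y => by simp⟩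
              · exact ⟨i₀, 0, if (List.ofFn p).getD l false then 1 else 0, fun y => by simp⟩)
          have hG' : ∀ y : Fin n → Bool, g.op (fun a => wireOf y (List.ofFn p) (g.args a)) =
              decide (θ ≤ ∑ j, w j * (if y j then (1 : ℤ) else 0)) := hG
          simp only [hG']
          exact SensLtf.sens_intLtf_le w θ π
        calc _ ≤ ∑ l : Fin gs.length, (3 : ℝ) ^ (l : ℕ) * (2 ^ n * Real.sqrt m) +
              2 ^ gs.length * (2 ^ n * Real.sqrt m) :=
              sens_select_le π (fun y : Fin n → Bool => g.op (fun a => wireOf y (vals gs y) (g.args a)))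
                (fun (y : Fin n → Bool) (l : Fin gs.length) => (vals gs y).getD l false)
                (fun (p : Fin gs.length → Bool) (y : Fin n → Bool) =>
                  g.op (fun a => wireOf y (List.ofFn p) (g.args a)))
                hf (b := fun l : Fin gs.length => (3 : ℝ) ^ (l : ℕ) * (2 ^ n * Real.sqrt m))
                (fun l => ih hB' l.isLt) hGp
          _ = ((∑ l ∈ range gs.length, (3 : ℝ) ^ l) + 2 ^ gs.length) * (2 ^ n * Real.sqrt m) := by
              rw [add_mul, sum_mul, ← Fin.sum_univ_eq_sum_range]
          _ ≤ 3 ^ gs.length * (2 ^ n * Real.sqrt m) :=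
              mul_le_mul_of_nonneg_right (geom_three_two _) hZ

end SizeKSens

/-- **Stub `stub_sizeK_sens` (line `Sketch` v5, crux `LiouvilleOrthogonalTC0`) — block sensitivity
of bounded-size threshold circuits.** A circuit over `tcBasis` with `≤ K` gates has block
sensitivity `≤ 3^K · 2ⁿ √m` for every `m`-partition `π` of the inputs (`m ≥ 1`): gate `t` is a
threshold of an affine form in the inputs plus earlier gate values, i.e. one of `2ᵗ` integer
threshold functions selected by the earlier values; union bound, Peres' bound `2ⁿ √m` for each
threshold function (`SensLtf.sens_intLtf_le`), and `Σ_{l<t} 3ˡ + 2ᵗ ≤ 3ᵗ`. -/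
theorem stub_sizeK_sens {n m : ℕ} (K : ℕ) (C : Circuit (Fin n)) (hB : C.IsOver tcBasis)
    (hs : C.size ≤ K) (hm : 1 ≤ m) (π : Fin n → Fin m) :
    ∑ x : Fin n → Bool, ((univ.filter fun j : Fin m =>
        C.eval x ≠ C.eval (fun i => xor (x i) (decide (π i = j)))).card : ℝ)
      ≤ 3 ^ K * (2 ^ n * Real.sqrt m) := by
  rcases isEmpty_or_nonempty (Fin n) with hn | ⟨⟨i₀⟩⟩
  · -- no inputs: no block is ever sensitive
    have hflip : ∀ (x : Fin n → Bool) (j : Fin m),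
        C.eval (fun i => xor (x i) (decide (π i = j))) = C.eval x :=
      fun x j => congrArg C.eval (funext fun i => hn.elim i)
    simp only [hflip, ne_eq, not_true_eq_false, filter_false, card_empty, Nat.cast_zero,
      sum_const_zero]
    positivity
  have hZ : (0 : ℝ) ≤ 2 ^ n * Real.sqrt m := by positivity
  simp only [circuit_eval]
  rcases hC : C.output with i | t
  · simp only [wireOf_inl]
    exact SizeKSens.sens_input_le hm π i K
  · simp only [wireOf_inr]
    have ht : t < C.gates.length := C.wf_output t hC
    have htK : t ≤ K := by
      have : C.gates.length ≤ K := hs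
      omega
    exact (SizeKSens.sens_vals_le i₀ hm π C.gates hB ht).trans
      (mul_le_mul_of_nonneg_right (pow_le_pow_right₀ (by norm_num) htK) hZ)

end Summit.QuantumAdvantage.QuantumAdvantage.Theorems.LiouvilleOrthogonalTC0
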